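import Summits.QuantumFields.QCD.Theses.EulerDescent
import Summits.QuantumFields.YangMills.Theorems.HypercubicLimit.Negative.NonTrivialityBridge
import Literature.MathematicalPhysics.QuantumFieldTheory.QCDAsymptoticScalingCouplingDivergence
import Literature.MathematicalPhysics.QuantumFieldTheory.QCDGoldstoneBound
import Literature.MathematicalPhysics.QuantumFieldTheory.SchwingerLimitInheritance

/-!
# Disproof of `HonestHeavyAnchor` — standing adversary, crux `stmt-QuantumFields-16901` (route `EulerDescent`, QCD)

Cycle 1 (cdisprove seat `refuter-cdisprove-stmt-QuantumFields-16901-0`, 2026-08-17).  VERDICT SO FAR: **no kill**.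
Everything below is CHECKED Lean (`lean check` rc 0, no `sorry` unless marked NEAR-MISS); prose only in docstrings.

## Findings (index)

* §0 currency = the crux's own clauses (`NonMassive`, `IsCorner`, `cornerOffset`, `Body`), definitionally the
  objects of `Lines/bounded_locator.lean` / `CruxAttack.lean`; §1 `honestHeavyAnchor_iff` unbundles the crux (`Iff.rfl`).
* §2 **Corner side — what the witness is committed to, and the ONLY three corner-side kill scenarios.**
  `beta_tendsto_atTop` (two-loop scaling ⇒ `β_k → +∞`), `mcrit_sub_corner_tendsto_zero` (the RGI pin is a
  LATTICE-unit pin: `m_crit(k) − mc(k) → 0`, because `a_k/Z_m(k) → 0`), `corner_eventually_gt` (pin + branch ⇒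
  `mc k > −1 − ε` eventually), `exists_nonMassive_gt` (so at every large `β_k` there is a NON-MASSIVE degenerate
  bare mass ABOVE `−1 − ε`: a transition of the Wilson axis above the doubler zone, seen by the `(−1)^F`-twisted
  odd-torus functional `qcdTorusExpect`).  Kill scenarios, each a statement about the FIXED-COUPLING lattice phase
  diagram and each believed false (so none is filed `--negative-modulo`): `false_of_allMassive` (no transition at
  weak coupling), `false_of_masslessPhase` (no clustering at weak coupling for arbitrarily heavy quarks —
  Patrascioiu–Seiler-type scenario, the `BddAbove` half), `false_of_deepCorner` (the only non-massive points at weak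
  coupling lie at or below `−1 − ε`, i.e. doublers only).  A disproof through the corner must PROVE one of these
  three lattice statements at cofinally many couplings of EVERY two-loop sequence — each is harder than the
  crux's own stub S2.
* §3 **The pin is intrinsic** (`corner_eventuallyEq`, `cornerOffset_eventuallyEq`, `pin_iff_of_isCorner`): two
  corner sequences of one regularisation agree eventually, so the offset of S3/S4 has no freedom in `mc`.
* §4 **Body side.** No junk inhabitant (CruxAttack `shell_trivial` + `OSData.not_isNontrivial_vacuum`: the
  content sits in corner + non-triviality + `HasLatticeMassGap`).  NEW remark-lemma `pairwise_clustering_of_latticeGap`: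
  the body's lattice gap certifies clustering at its own degenerate bare points only PAIR-BY-PAIR eventually
  (`∀ A B, ∀ᶠ k`), never `∀ᶠ k, m_f(k) ∉ NonMassive(β_k)` (`∀ᶠ k, ∀ A B`) — the quantifier gap that keeps the
  corner clause logically independent of the body (no internal inconsistency to exploit, no shortcut for S2's
  `BddAbove` half either).
* §5 **Line `bounded_locator` (PICKED).**  `exists_reg_of_tendsto_beta`: EVERY divergent coupling sequence
  `β_k → +∞` is realised EXACTLY (`β_k = afBeta N_f 1 a_k` eventually) by a mass-scaling, two-loop-scaling
  regularisation — so the packaging `∀ reg, HasAsymptoticScaling →` of stub S2 (and S3/S4) is inert: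
  `stub_intrinsicCorner_iff_cornerLaw` : S2 ⟺ `∀ N_f ∈ {2,3}, CornerLaw N_f` ("along EVERY `β_k → +∞` the
  non-massive set eventually has a LUB, tending to `0`") ⟺ (`cornerLaw_iff_fixedCoupling`) the sequence-free
  FIXED-COUPLING law "for all large `β`, `NonMassive N_f β` has a least upper bound `m_c(β)`, and `m_c(β) → 0` as
  `β → ∞`".  S2 is therefore a theorem about the Wilson-fermion lattice phase diagram ALONE (YM-at-fixed-β hard in
  its `BddAbove` half, chiral-transition hard in its `Nonempty` half), uniform over nothing.  Slack noted for the
  lead: the crux needs the corner only along the anchor's OWN sequence (S2 is universal); S2's `mc → 0` is used by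
  the glue only through `liminf mc > −1`; the `HasAsymptoticScaling` hypothesis of S3/S4 is implied by `BodyAbove`
  (`hasAsymptoticScaling_of_body`).  S3/S4 themselves are not junk-attackable (their hypothesis `BodyAbove` has no
  junk inhabitant and no inhabitant at all is in hand — S1 = ThresholdQCD, stmt-8794, open), and the composition
  `HonestHeavyAnchor_of` is kernel-checked (landed p166185): no smuggled gap.
* §6 **Body side — what non-triviality commits the witness to AT THE LATTICE LEVEL** (NEW; species-generic bridge
  `twoPointNontrivial_iff_real` of the YM negative file `HypercubicLimit/Negative/NonTrivialityBridge.lean` imported):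
  `lattice_truncated_eventually_ne_zero` (IsQCDAlong + `IsNontrivial s` ⇒ a REAL truncated lattice two-point value of
  species `s` is non-zero for all large `k`), hence `partition_eventually_ne_zero` (the honest `(−1)^F`-twisted
  partition function at the scheme's OWN side `2L_k+1` is non-zero eventually — a zero denominator makes every
  lattice Schwinger function junk-`0`) and `z_eventually_ne_zero` (`z_s(k) ≠ 0` eventually).  For the crux:
  `witness_partition_eventually_ne_zero` — at EVERY heavy tuple the twisted partition function at
  `(β_k, 2L_k+1, m_crit(k) + a_k m_f/Z_m(k))` is eventually non-zero.  Teeth: the witness's bare masses tend to the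
  corner `mc(k) = sup NonMassive(β_k)`, expected NEGATIVE (`κ_c > 1/8`), where `∏_f det D_W` is real but not
  configuration-wise positive (`WilsonDeterminantSign`): for `N_f = 3` (or split `N_f = 2`) a sign-problem statement,
  the `≠ 0` shadow of `stub_honestPartitionPos` of line `block-away-the-sign` (crux `ExtinctionBuildsQCD`).
* WHY IT RESISTS (summary for provers): the crux is `∃ reg` over honest functionals; every clause with teeth is an
  open statement about lattice QCD at weak coupling in BOTH directions (corner: transition + clustering at fixed
  `β`; body: ThresholdQCD).  No bespoke analytic clause (contrast the killed 9599), no junk functional (`qcdTorusExpect`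
  is junk-0 only where the twisted partition function vanishes; `det D_W > 0` configuration-wise for bare mass `> 0`),
  no finite falsifier.  Literature: both Sharpe–Singleton scenarios (Aoki phase / first-order coexistence,
  SharpeSingleton1998, Aoki1984WilsonPhase) make `NonMassive(β) ∩ (−1, ∞)` non-empty near `m' = 0`; the massless
  weak-coupling phase (Patrascioiu–Seiler) is the only printed scenario for `¬BddAbove`, numerically disfavoured.
-/

noncomputable section

namespace Summit.QuantumFields.QCD.Cruxes.HonestHeavyAnchor.Disproof

open scoped Topology
open Filter
open Literature.MathematicalPhysics.QuantumFieldTheory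
open Summit.QuantumFields.QCD.Theses.EulerDescent (HonestHeavyAnchor)

variable {Nf : ℕ}

/-! ## §0 Currency (the crux's own clauses; definitionally those of `Lines/bounded_locator.lean`) -/

variable (Nf) in
/-- The NON-MASSIVE degenerate bare Wilson masses at inverse coupling `β` (the crux's inlined set, verbatim). -/
def NonMassive (β : ℝ) : Set ℝ :=
  {μ : ℝ | ¬ (∀ (R R' : ℕ) (A : QCDLatticeObservable Nf R) (B : QCDLatticeObservable Nf R'),
    ∃ (C δ : ℝ) (S₀ : ℕ), 0 < δ ∧ ∀ S : ℕ, S₀ ≤ S → ∀ n : ℕ, n ≤ S →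
      ‖qcdLatticeConnectedCorr β (2 * S + 1) (fun _ : Fin Nf => μ) A B n‖ ≤ C * Real.exp (-(δ * n)))}

/-- `mc` is eventually the intrinsic Wilson corner of `reg` (the crux's corner clause; reads only `reg.β`). -/
def IsCorner (reg : QCDRegularisation Nf) (mc : ℕ → ℝ) : Prop :=
  ∀ᶠ k in atTop, IsLUB (NonMassive Nf (reg.β k)) (mc k)

/-- The renormalised corner offset `(m_crit(k) − mc(k))·Z_m(k)/a_k` (the pin clause is `cornerOffset → 0`). -/
def cornerOffset (reg : QCDRegularisation Nf) (mc : ℕ → ℝ) (k : ℕ) : ℝ :=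
  (reg.mcrit k - mc k) * reg.Zm k / reg.a k

/-- The crux's heavy body above `Mh` (non-strict threshold, verbatim). -/
def Body (reg : QCDRegularisation Nf) (Mh : ℝ) : Prop :=
  ∀ m : Fin Nf → ℝ, (∀ f, Mh ≤ m f) →
    ∃ (z shift : QCDField Nf → ℕ → ℝ) (T : OSData (QCDField Nf) 4),
      IsQCDAlong (reg.scheme m z shift) T ∧ T.IsNontrivial QCDField.glue ∧
        T.IsNonGaussian QCDField.glue ∧
          (∀ f g : Fin Nf, f ≠ g → T.IsNontrivial (QCDField.pseudoRe f g)) ∧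
            ∃ Δ > 0, T.HasMassGap Δ ∧ (reg.scheme m z shift).HasLatticeMassGap Δ

/-! ## §1 Unbundling -/

/-- **The crux, unbundled** (definitional). -/
theorem honestHeavyAnchor_iff :
    HonestHeavyAnchor ↔
      ∀ Nf : ℕ, Nf = 2 ∨ Nf = 3 → ∃ (reg : QCDRegularisation Nf) (mc : ℕ → ℝ) (Mh : ℝ),
        IsCorner reg mc ∧ Tendsto (cornerOffset reg mc) atTop (𝓝 0) ∧ reg.HasMassScaling ∧
          (reg.scheme 0 0 0).HasAsymptoticScaling ∧ (∀ᶠ k in atTop, (-1 : ℝ) < reg.mcrit k) ∧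
            0 < Mh ∧ Body reg Mh :=
  Iff.rfl

/-! ## §2 Corner side: commitments of the witness and the three kill scenarios -/

/-- Two-loop asymptotic scaling forces `β_k → +∞` for `N_f = 2, 3` (Literature
`QCDScheme.tendsto_beta_atTop_of_hasAsymptoticScaling`, `N_f ≤ 16`). [folklore] -/
theorem beta_tendsto_atTop (hNf : Nf = 2 ∨ Nf = 3) (reg : QCDRegularisation Nf)
    (haf : (reg.scheme 0 0 0).HasAsymptoticScaling) : Tendsto reg.β atTop atTop := by
  have h16 : Nf ≤ 16 := by rcases hNf with rfl | rfl <;> norm_num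
  exact QCDScheme.tendsto_beta_atTop_of_hasAsymptoticScaling h16 (reg.scheme 0 0 0) haf

/-- The leading-log mass exponent `γ₀/(2β₀)` is non-negative for `N_f = 2, 3`. [folklore] -/
theorem massExponent_nonneg (hNf : Nf = 2 ∨ Nf = 3) : 0 ≤ massExponent Nf := by
  have hb : 0 < betaCoeff₀ Nf := by
    rcases hNf with rfl | rfl <;> norm_num [betaCoeff₀] <;> positivity
  unfold massExponent gammaCoeff₀
  positivity

/-- **`a_k / Z_m(k) → 0`** for a mass-scaling regularisation (`N_f = 2, 3`): the conversion factor between the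
RGI pin and the lattice-unit pin vanishes.  (Same statement as the landed
`HonestHeavyAnchorSplit.tendsto_a_div_Zm`; re-proved to keep this work file independent of build state.) [folklore] -/
theorem a_div_Zm_tendsto_zero (hNf : Nf = 2 ∨ Nf = 3) (reg : QCDRegularisation Nf)
    (hms : reg.HasMassScaling) : Tendsto (fun k => reg.a k / reg.Zm k) atTop (𝓝 0) := by
  have hγ := massExponent_nonneg hNf
  obtain ⟨c, hc, hZ⟩ := hms
  have h1 : Tendsto (fun k => 1 / reg.a k ^ 2) atTop atTop := by
    have ha2 : Tendsto (fun k => reg.a k ^ 2) atTop (𝓝[>] 0) := by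
      refine tendsto_nhdsWithin_iff.2 ⟨?_, Eventually.of_forall fun k => pow_pos (reg.a_pos k) 2⟩
      simpa using reg.tendsto_a.pow 2
    simpa [one_div, Function.comp_def] using tendsto_inv_nhdsGT_zero.comp ha2
  have hL : Tendsto (fun k => Real.log (1 / reg.a k ^ 2)) atTop atTop := Real.tendsto_log_atTop.comp h1
  have hLγ : ∀ᶠ k in atTop, 1 ≤ Real.log (1 / reg.a k ^ 2) ^ massExponent Nf := by
    filter_upwards [hL.eventually_ge_atTop 1] with k hk
    exact Real.one_le_rpow hk hγ
  have hZ2 : ∀ᶠ k in atTop, c / 2 < reg.Zm k / Real.log (1 / reg.a k ^ 2) ^ massExponent Nf :=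
    hZ.eventually_const_lt (by linarith)
  have hZm : ∀ᶠ k in atTop, c / 2 ≤ reg.Zm k := by
    filter_upwards [hLγ, hZ2] with k h1 h2
    have hpos : 0 < Real.log (1 / reg.a k ^ 2) ^ massExponent Nf := by linarith
    rw [lt_div_iff₀ hpos] at h2
    nlinarith [h2, h1, hc]
  have hg : Tendsto (fun k => reg.a k / (c / 2)) atTop (𝓝 0) := by
    simpa using reg.tendsto_a.div_const (c / 2)
  refine squeeze_zero' (Eventually.of_forall fun k => (div_pos (reg.a_pos k) (reg.Zm_pos k)).le) ?_ hg
  filter_upwards [hZm] with k hk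
  exact div_le_div_of_nonneg_left (reg.a_pos k).le (by linarith) hk

/-- **The RGI pin is a lattice-unit pin**: `cornerOffset → 0` and mass scaling give `m_crit(k) − mc(k) → 0`
(indeed `= cornerOffset(k) · a_k/Z_m(k)` with both factors `→ 0`). [folklore] -/
theorem mcrit_sub_corner_tendsto_zero (hNf : Nf = 2 ∨ Nf = 3) (reg : QCDRegularisation Nf) (mc : ℕ → ℝ)
    (hms : reg.HasMassScaling) (hpin : Tendsto (cornerOffset reg mc) atTop (𝓝 0)) :
    Tendsto (fun k => reg.mcrit k - mc k) atTop (𝓝 0) := by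
  have h := hpin.mul (a_div_Zm_tendsto_zero hNf reg hms)
  rw [mul_zero] at h
  refine h.congr fun k => ?_
  have ha : reg.a k ≠ 0 := (reg.a_pos k).ne'
  have hZ : reg.Zm k ≠ 0 := (reg.Zm_pos k).ne'
  simp only [cornerOffset]
  field_simp

/-- **Pin + branch put the corner eventually above `−1 − ε`** for every `ε > 0`. [folklore] -/
theorem corner_eventually_gt (hNf : Nf = 2 ∨ Nf = 3) (reg : QCDRegularisation Nf) (mc : ℕ → ℝ)
    (hms : reg.HasMassScaling) (hpin : Tendsto (cornerOffset reg mc) atTop (𝓝 0))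
    (hbranch : ∀ᶠ k in atTop, (-1 : ℝ) < reg.mcrit k) {ε : ℝ} (hε : 0 < ε) :
    ∀ᶠ k in atTop, -1 - ε < mc k := by
  have h := (mcrit_sub_corner_tendsto_zero hNf reg mc hms hpin).eventually_lt_const hε
  filter_upwards [h, hbranch] with k hk hb
  linarith

/-- **What the witness is committed to on the Wilson axis**: at every large `β_k` there is a NON-MASSIVE
degenerate bare mass strictly above `−1 − ε` — a transition point above the doubler zone, for the twisted
odd-torus functional. [folklore] -/
theorem exists_nonMassive_gt (hNf : Nf = 2 ∨ Nf = 3) (reg : QCDRegularisation Nf) (mc : ℕ → ℝ)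
    (hcorner : IsCorner reg mc) (hms : reg.HasMassScaling)
    (hpin : Tendsto (cornerOffset reg mc) atTop (𝓝 0)) (hbranch : ∀ᶠ k in atTop, (-1 : ℝ) < reg.mcrit k)
    {ε : ℝ} (hε : 0 < ε) :
    ∀ᶠ k in atTop, ∃ μ ∈ NonMassive Nf (reg.β k), -1 - ε < μ := by
  filter_upwards [hcorner, corner_eventually_gt hNf reg mc hms hpin hbranch hε] with k hk hgt
  by_contra hno
  simp only [not_exists, not_and, not_lt] at hno
  have hub : mc k ≤ -1 - ε := hk.2 fun μ hμ => hno μ hμ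
  linarith

/-- **Corner-side commitments of any witness of the crux**, packaged: a two-loop (`β_k → ∞`) sequence along
which, eventually, `NonMassive(β_k)` is non-empty ABOVE `−1 − ε` (every `ε > 0`), bounded above, and every
degenerate bare mass above the corner is massive. [folklore] -/
theorem witness_corner_commitments (h : HonestHeavyAnchor) (hNf : Nf = 2 ∨ Nf = 3) :
    ∃ (reg : QCDRegularisation Nf) (mc : ℕ → ℝ), Tendsto reg.β atTop atTop ∧ IsCorner reg mc ∧
      (∀ ε : ℝ, 0 < ε → ∀ᶠ k in atTop, ∃ μ ∈ NonMassive Nf (reg.β k), -1 - ε < μ) ∧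
      ∀ᶠ k in atTop, BddAbove (NonMassive Nf (reg.β k)) ∧ ∀ μ : ℝ, mc k < μ → μ ∉ NonMassive Nf (reg.β k) := by
  obtain ⟨reg, mc, Mh, hcorner, hpin, hms, haf, hbranch, -, -⟩ := h Nf hNf
  refine ⟨reg, mc, beta_tendsto_atTop hNf reg haf, hcorner,
    fun ε hε => exists_nonMassive_gt hNf reg mc hcorner hms hpin hbranch hε, ?_⟩
  filter_upwards [hcorner] with k hk
  exact ⟨hk.bddAbove, fun μ hμ hmem => (not_lt.2 (hk.1 hmem)) hμ⟩

variable (Nf) in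
/-- KILL SCENARIO 1 (believed false — Sharpe–Singleton: Aoki edge or first-order coexistence near `m' = 0`):
**no transition on the Wilson axis at weak coupling** — for all large `β` every degenerate bare mass is massive. -/
def AllMassiveAtWeakCoupling : Prop :=
  ∃ β₀ : ℝ, ∀ β : ℝ, β₀ ≤ β → NonMassive Nf β = ∅

variable (Nf) in
/-- KILL SCENARIO 2 (believed false; the Patrascioiu–Seiler-type massless weak-coupling phase is its only
printed proponent): **no bound on the non-massive set at weak coupling** — arbitrarily heavy degenerate quarks
fail to make the twisted-torus theory cluster. -/
def MasslessWeakCouplingPhase : Prop :=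
  ∃ β₀ : ℝ, ∀ β : ℝ, β₀ ≤ β → ¬ BddAbove (NonMassive Nf β)

variable (Nf) in
/-- KILL SCENARIO 3 (believed false — `κ_c(β) → 1/8`, i.e. `m_c(β) → 0⁻`): **only deep (doubler) transitions at
weak coupling** — every non-massive degenerate bare mass lies at or below `−1 − ε`. -/
def DeepCornerOnly : Prop :=
  ∃ β₀ ε : ℝ, 0 < ε ∧ ∀ β : ℝ, β₀ ≤ β → ∀ μ ∈ NonMassive Nf β, μ ≤ -1 - ε

/-- Scenario 1 kills the crux (`IsLUB ∅ x` is false in `ℝ`). [folklore] -/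
theorem false_of_allMassive (hNf : Nf = 2 ∨ Nf = 3) (H : AllMassiveAtWeakCoupling Nf) : ¬ HonestHeavyAnchor := by
  intro h
  obtain ⟨reg, mc, hβ, hcorner, -, -⟩ := witness_corner_commitments h hNf
  obtain ⟨β₀, hβ₀⟩ := H
  obtain ⟨k, hk, hk'⟩ := (hcorner.and (hβ.eventually_ge_atTop β₀)).exists
  have hne := hk.nonempty
  rw [hβ₀ _ hk'] at hne
  exact Set.not_nonempty_empty hne

/-- Scenario 2 kills the crux (an `IsLUB` set is bounded above). [folklore] -/
theorem false_of_masslessPhase (hNf : Nf = 2 ∨ Nf = 3) (H : MasslessWeakCouplingPhase Nf) :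
    ¬ HonestHeavyAnchor := by
  intro h
  obtain ⟨reg, mc, hβ, hcorner, -, -⟩ := witness_corner_commitments h hNf
  obtain ⟨β₀, hβ₀⟩ := H
  obtain ⟨k, hk, hk'⟩ := (hcorner.and (hβ.eventually_ge_atTop β₀)).exists
  exact hβ₀ _ hk' hk.bddAbove

/-- Scenario 3 kills the crux (against `exists_nonMassive_gt`: pin + branch need a non-massive point above
`−1 − ε`). [folklore] -/
theorem false_of_deepCorner (hNf : Nf = 2 ∨ Nf = 3) (H : DeepCornerOnly Nf) : ¬ HonestHeavyAnchor := by
  intro h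
  obtain ⟨reg, mc, hβ, -, hne, -⟩ := witness_corner_commitments h hNf
  obtain ⟨β₀, ε, hε, hβ₀⟩ := H
  obtain ⟨k, ⟨μ, hμ, hgt⟩, hk'⟩ := ((hne ε hε).and (hβ.eventually_ge_atTop β₀)).exists
  have := hβ₀ _ hk' μ hμ
  linarith

/-! ## §3 The pin is intrinsic: corner uniqueness -/

/-- Two corner sequences of the same regularisation agree eventually (`IsLUB` is unique). [folklore] -/
theorem corner_eventuallyEq (reg : QCDRegularisation Nf) {mc mc' : ℕ → ℝ} (h : IsCorner reg mc)
    (h' : IsCorner reg mc') : mc =ᶠ[atTop] mc' := by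
  filter_upwards [h, h'] with k hk hk'
  exact hk.unique hk'

/-- Hence the renormalised offsets agree eventually … [folklore] -/
theorem cornerOffset_eventuallyEq (reg : QCDRegularisation Nf) {mc mc' : ℕ → ℝ} (h : IsCorner reg mc)
    (h' : IsCorner reg mc') : cornerOffset reg mc =ᶠ[atTop] cornerOffset reg mc' := by
  filter_upwards [corner_eventuallyEq reg h h'] with k hk
  simp only [cornerOffset, hk]

/-- … and the pin (indeed any limit / bound of the offset) does not depend on the choice of corner sequence:
the locator stubs S3/S4 have no freedom in `mc`. [folklore] -/
theorem pin_iff_of_isCorner (reg : QCDRegularisation Nf) {mc mc' : ℕ → ℝ} (h : IsCorner reg mc)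
    (h' : IsCorner reg mc') (c : ℝ) :
    Tendsto (cornerOffset reg mc) atTop (𝓝 c) ↔ Tendsto (cornerOffset reg mc') atTop (𝓝 c) :=
  ⟨fun ht => ht.congr' (cornerOffset_eventuallyEq reg h h'),
    fun ht => ht.congr' (cornerOffset_eventuallyEq reg h' h)⟩

/-! ## §4 Body side: the lattice gap certifies clustering at its own bare points only pair-by-pair -/

/-- **Quantifier gap between the body's lattice gap and the corner's massiveness.**  `HasLatticeMassGap Δ` at the
DEGENERATE tuple `m ≡ M` gives, for EACH pair of observables separately, eventual-in-`k` exponential clustering at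
the bare points `m_crit(k) + a_k M / Z_m(k)` (rate `Δ a_k`, constants uniform in the volume) — `∀ A B, ∀ᶠ k`.  The
corner's "massive at `μ`" is `∀ A B` at ONE `k`; the swap `∀ᶠ k, ∀ A B` is not available (uncountably many pairs,
pair-dependent thresholds), which is why the body neither contradicts nor shortens the corner clause. [folklore] -/
theorem pairwise_clustering_of_latticeGap (reg : QCDRegularisation Nf) (M : ℝ) (z shift : QCDField Nf → ℕ → ℝ)
    {Δ : ℝ} (hΔ : 0 < Δ) (h : (reg.scheme (fun _ => M) z shift).HasLatticeMassGap Δ)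
    {R R' : ℕ} (A : QCDLatticeObservable Nf R) (B : QCDLatticeObservable Nf R') :
    ∀ᶠ k in atTop, ∃ (C δ : ℝ) (S₀ : ℕ), 0 < δ ∧ ∀ S : ℕ, S₀ ≤ S → ∀ n : ℕ, n ≤ S →
      ‖qcdLatticeConnectedCorr (reg.β k) (2 * S + 1) (fun _ : Fin Nf => reg.mcrit k + reg.a k * M / reg.Zm k)
        A B n‖ ≤ C * Real.exp (-(δ * n)) := by
  obtain ⟨C, hC⟩ := h R R' A B
  filter_upwards [hC] with k hk
  refine ⟨C, Δ * reg.a k, reg.L k, mul_pos hΔ (reg.a_pos k), fun S hS n hn => ?_⟩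
  have h1 := hk S hS n hn
  have h2 : -(Δ * (reg.a k * (n : ℝ))) = -(Δ * reg.a k * n) := by ring
  simpa [QCDRegularisation.scheme, h2] using h1


/-! ## §5 Line `bounded_locator` (PICKED): S2 ⟺ the fixed-coupling corner law; slack in S2–S4 -/

section Line

/-- The two-loop profile `a ↦ afBeta N_f 1 a` is continuous on `(0, 1)`. [folklore] -/
theorem continuousOn_afBeta_one (Nf : ℕ) : ContinuousOn (fun a : ℝ => afBeta Nf 1 a) (Set.Ioo 0 1) := by
  have hq : ∀ a ∈ Set.Ioo (0 : ℝ) 1, 1 < 1 / (a ^ 2 * (1 : ℝ) ^ 2) := by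
    intro a ha
    have ha2 : a ^ 2 < 1 := by nlinarith [ha.1, ha.2]
    rw [one_pow, mul_one, lt_div_iff₀ (pow_pos ha.1 2), one_mul]
    exact ha2
  have h1 : ContinuousOn (fun a : ℝ => 1 / (a ^ 2 * (1 : ℝ) ^ 2)) (Set.Ioo 0 1) := by
    refine continuousOn_const.div (by fun_prop) fun a ha => ?_
    exact (mul_pos (pow_pos ha.1 2) (by norm_num)).ne'
  have h2 : ContinuousOn (fun a : ℝ => Real.log (1 / (a ^ 2 * (1 : ℝ) ^ 2))) (Set.Ioo 0 1) :=
    h1.log fun a ha => (zero_lt_one.trans (hq a ha)).ne'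
  have h3 : ContinuousOn (fun a : ℝ => Real.log (Real.log (1 / (a ^ 2 * (1 : ℝ) ^ 2)))) (Set.Ioo 0 1) :=
    h2.log fun a ha => (Real.log_pos (hq a ha)).ne'
  unfold afBeta
  exact (continuousOn_const.mul h2).add (continuousOn_const.mul h3)

/-- **Every large inverse coupling is attained by the two-loop profile at a spacing in `(0, 1/2]`**
(`N_f ≤ 16`): divergence of the profile along `a_k = 1/(k+1)` plus the intermediate value theorem. [folklore] -/
theorem exists_afBeta_one_eq (hNf16 : Nf ≤ 16) :
    ∃ B₀ : ℝ, ∀ b : ℝ, B₀ ≤ b → ∃ a : ℝ, 0 < a ∧ a ≤ 1 / 2 ∧ afBeta Nf 1 a = b := by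
  refine ⟨afBeta Nf 1 (1 / 2), fun b hb => ?_⟩
  have hseq : Tendsto (fun k : ℕ => afBeta Nf 1 (1 / ((k : ℝ) + 1))) atTop atTop :=
    tendsto_afBeta_atTop hNf16 one_pos (a := fun k : ℕ => 1 / ((k : ℝ) + 1)) (fun k => by positivity)
      tendsto_one_div_add_atTop_nhds_zero_nat
  obtain ⟨k, hk, hk1⟩ := ((hseq.eventually_ge_atTop b).and (eventually_ge_atTop 1)).exists
  set a₁ : ℝ := 1 / ((k : ℝ) + 1) with ha₁
  have hk1' : (1 : ℝ) ≤ k := by exact_mod_cast hk1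
  have ha₁pos : 0 < a₁ := by rw [ha₁]; positivity
  have ha₁le : a₁ ≤ 1 / 2 := by
    rw [ha₁, div_le_div_iff₀ (by positivity) (by norm_num)]
    linarith
  have hcont : ContinuousOn (fun a : ℝ => afBeta Nf 1 a) (Set.Icc a₁ (1 / 2)) :=
    (continuousOn_afBeta_one Nf).mono fun x hx => ⟨ha₁pos.trans_le hx.1, hx.2.trans_lt (by norm_num)⟩
  have hmem : b ∈ Set.Icc (afBeta Nf 1 (1 / 2)) (afBeta Nf 1 a₁) := ⟨hb, hk⟩
  obtain ⟨a, ⟨ha1, ha2⟩, hfa⟩ := intermediate_value_Icc' ha₁le hcont hmem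
  exact ⟨a, ha₁pos.trans_le ha1, ha2, hfa⟩

/-- **Every divergent coupling sequence is realised EXACTLY by a mass-scaling, two-loop-scaling regularisation**
(`N_f = 2, 3`): for `β_k → +∞` there is `reg` with `reg.β = β`, `(reg.scheme 0 0 0).HasAsymptoticScaling`
(indeed `β_k = afBeta N_f 1 a_k` for all large `k`, `a_k → 0⁺`, `a_k L_k → ∞`) and `reg.HasMassScaling`
(`Z_m(k) = (log a_k⁻²)^{γ₀/(2β₀)}`, `c = 1`).  So the packaging `∀ reg, HasAsymptoticScaling → …` of the line's
stubs quantifies over ALL divergent coupling sequences and nothing else. [folklore] -/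
theorem exists_reg_of_tendsto_beta (hNf : Nf = 2 ∨ Nf = 3) (β : ℕ → ℝ) (hβ : Tendsto β atTop atTop) :
    ∃ reg : QCDRegularisation Nf, reg.β = β ∧ (reg.scheme 0 0 0).HasAsymptoticScaling ∧ reg.HasMassScaling := by
  classical
  have h16 : Nf ≤ 16 := by rcases hNf with rfl | rfl <;> norm_num
  obtain ⟨B₀, hsol⟩ := exists_afBeta_one_eq (Nf := Nf) h16
  -- the spacing realising the coupling `b` (junk `1/2` below `B₀`)
  let sel : ℝ → ℝ := fun b => if h : B₀ ≤ b then Classical.choose (hsol b h) else 1 / 2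
  have hsel_pos : ∀ b, 0 < sel b := by
    intro b
    by_cases h : B₀ ≤ b
    · simp only [sel, dif_pos h]
      exact (Classical.choose_spec (hsol b h)).1
    · simp only [sel, dif_neg h]
      norm_num
  have hsel_le : ∀ b, sel b ≤ 1 / 2 := by
    intro b
    by_cases h : B₀ ≤ b
    · simp only [sel, dif_pos h]
      exact (Classical.choose_spec (hsol b h)).2.1
    · simp only [sel, dif_neg h]
      norm_num
  have hsel_eq : ∀ b, B₀ ≤ b → afBeta Nf 1 (sel b) = b := by
    intro b h
    simp only [sel, dif_pos h]
    exact (Classical.choose_spec (hsol b h)).2.2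
  let a : ℕ → ℝ := fun k => sel (β k)
  have ha_pos : ∀ k, 0 < a k := fun k => hsel_pos _
  have ha_le : ∀ k, a k ≤ 1 / 2 := fun k => hsel_le _
  have ha_eq : ∀ k, B₀ ≤ β k → afBeta Nf 1 (a k) = β k := fun k hk => hsel_eq _ hk
  -- `a_k → 0`: the profile is bounded on `[ε, 1/2]`, while `afBeta (a_k) = β_k → ∞`
  have ha0 : Tendsto a atTop (𝓝 0) := by
    rw [tendsto_order]
    refine ⟨fun a' ha' => Eventually.of_forall fun k => ha'.trans (ha_pos k), fun ε hε => ?_⟩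
    obtain ⟨K, hK⟩ : ∃ K : ℝ, ∀ x ∈ Set.Icc ε (1 / 2), afBeta Nf 1 x ≤ K := by
      have hc : ContinuousOn (fun x : ℝ => afBeta Nf 1 x) (Set.Icc ε (1 / 2)) :=
        (continuousOn_afBeta_one Nf).mono fun x hx => ⟨hε.trans_le hx.1, hx.2.trans_lt (by norm_num)⟩
      obtain ⟨K, hK⟩ := isCompact_Icc.bddAbove_image hc
      exact ⟨K, fun x hx => hK ⟨x, hx, rfl⟩⟩
    filter_upwards [hβ.eventually_ge_atTop (max B₀ (K + 1))] with k hk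
    have hB : B₀ ≤ β k := le_trans (le_max_left _ _) hk
    have hKk : K + 1 ≤ β k := le_trans (le_max_right _ _) hk
    by_contra hnot
    have hmem : a k ∈ Set.Icc ε (1 / 2) := ⟨not_lt.1 hnot, ha_le k⟩
    have hle := hK (a k) hmem
    rw [ha_eq k hB] at hle
    linarith
  -- volumes `L_k = ⌈a_k⁻²⌉`, so `a_k L_k ≥ 1/a_k → ∞`
  have hinv : Tendsto (fun k => 1 / a k) atTop atTop := by
    have h' : Tendsto a atTop (𝓝[>] 0) := tendsto_nhdsWithin_iff.2 ⟨ha0, Eventually.of_forall ha_pos⟩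
    simpa [one_div, Function.comp_def] using tendsto_inv_nhdsGT_zero.comp h'
  have hL : Tendsto (fun k => a k * ((⌈1 / a k ^ 2⌉₊ : ℕ) : ℝ)) atTop atTop := by
    refine tendsto_atTop_mono (fun k => ?_) hinv
    have hak := ha_pos k
    have hak' : a k ≠ 0 := hak.ne'
    calc 1 / a k = a k * (1 / a k ^ 2) := by field_simp
      _ ≤ a k * ((⌈1 / a k ^ 2⌉₊ : ℕ) : ℝ) := mul_le_mul_of_nonneg_left (Nat.le_ceil _) hak.le
  -- `Z_m(k) = (log a_k⁻²)^γ > 0`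
  have hgt : ∀ k, 1 < 1 / a k ^ 2 := fun k => by
    have h1 : a k ^ 2 < 1 := by nlinarith [ha_pos k, ha_le k]
    rw [lt_div_iff₀ (pow_pos (ha_pos k) 2), one_mul]
    exact h1
  have hZpos : ∀ k, 0 < Real.log (1 / a k ^ 2) ^ massExponent Nf := fun k =>
    Real.rpow_pos_of_pos (Real.log_pos (hgt k)) _
  let reg : QCDRegularisation Nf :=
    { a := a, a_pos := ha_pos, tendsto_a := ha0, β := β, L := fun k => ⌈1 / a k ^ 2⌉₊, tendsto_L := hL,
      mcrit := fun _ => 0, Zm := fun k => Real.log (1 / a k ^ 2) ^ massExponent Nf, Zm_pos := hZpos }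
  refine ⟨reg, rfl, ⟨1, one_pos, ?_⟩, ⟨1, one_pos, ?_⟩⟩
  · refine tendsto_const_nhds.congr' ?_
    filter_upwards [hβ.eventually_ge_atTop B₀] with k hk
    show (0 : ℝ) = β k - afBeta Nf 1 (a k)
    rw [ha_eq k hk, sub_self]
  · refine tendsto_const_nhds.congr' (Eventually.of_forall fun k => ?_)
    show (1 : ℝ) = Real.log (1 / a k ^ 2) ^ massExponent Nf / Real.log (1 / a k ^ 2) ^ massExponent Nf
    rw [div_self (hZpos k).ne']

variable (Nf) in
/-- **The corner law along divergent coupling sequences**: along EVERY `β_k → +∞` the non-massive set eventually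
has a least upper bound `mc k`, and `mc k → 0`. -/
def CornerLaw : Prop :=
  ∀ β : ℕ → ℝ, Tendsto β atTop atTop →
    ∃ mc : ℕ → ℝ, (∀ᶠ k in atTop, IsLUB (NonMassive Nf (β k)) (mc k)) ∧ Tendsto mc atTop (𝓝 0)

/-- Stub S2 of the line (`Stmt.stub_intrinsicCorner`, verbatim up to the definitional currency `IsCorner`). -/
def StubIntrinsicCorner : Prop :=
  ∀ Nf : ℕ, Nf = 2 ∨ Nf = 3 → ∀ reg : QCDRegularisation Nf, (reg.scheme 0 0 0).HasAsymptoticScaling →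
    ∃ mc : ℕ → ℝ, IsCorner reg mc ∧ Tendsto mc atTop (𝓝 0)

/-- **S2 ⟺ the corner law along every divergent coupling sequence** (`N_f = 2, 3`): the regularisation and its
two-loop scaling hypothesis are inert packaging (⇒ by `exists_reg_of_tendsto_beta`, ⇐ by `β_k → ∞`). [folklore] -/
theorem stubIntrinsicCorner_iff_cornerLaw :
    StubIntrinsicCorner ↔ ∀ Nf : ℕ, Nf = 2 ∨ Nf = 3 → CornerLaw Nf := by
  constructor
  · intro h Nf hNf β hβ
    obtain ⟨reg, hreg, haf, -⟩ := exists_reg_of_tendsto_beta hNf β hβ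
    obtain ⟨mc, hc, hmc⟩ := h Nf hNf reg haf
    subst hreg
    exact ⟨mc, hc, hmc⟩
  · intro h Nf hNf reg haf
    obtain ⟨mc, hc, hmc⟩ := h Nf hNf reg.β (beta_tendsto_atTop hNf reg haf)
    exact ⟨mc, hc, hmc⟩

variable (Nf) in
/-- **The FIXED-COUPLING corner law** (no sequences, no regularisations): for all large `β` the non-massive set
`NonMassive N_f β` has a least upper bound — necessarily `m_c(β) := sSup (NonMassive N_f β)` — and `m_c(β) → 0`
as `β → +∞` (`κ_c(β) → 1/8`). -/
def FixedCouplingCornerLaw : Prop :=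
  (∃ β₀ : ℝ, ∀ β : ℝ, β₀ ≤ β → ∃ m : ℝ, IsLUB (NonMassive Nf β) m) ∧
    Tendsto (fun β : ℝ => sSup (NonMassive Nf β)) atTop (𝓝 0)

/-- **Sequences ⟺ function**: the corner law along every divergent coupling sequence is the fixed-coupling
corner law (`atTop` on `ℝ` is countably generated; `IsLUB` ⇒ `sSup`). Hence
S2 ⟺ `∀ N_f ∈ {2,3}, FixedCouplingCornerLaw N_f` — a statement about the Wilson-fermion lattice phase diagram at
fixed coupling alone. [folklore] -/
theorem cornerLaw_iff_fixedCoupling : CornerLaw Nf ↔ FixedCouplingCornerLaw Nf := by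
  constructor
  · intro h
    refine ⟨?_, ?_⟩
    · by_contra hno
      simp only [not_exists, not_forall, exists_prop] at hno
      choose g hg hno' using hno
      have hβ : Tendsto (fun k : ℕ => g k) atTop atTop :=
        tendsto_atTop_mono (fun k => hg k) tendsto_natCast_atTop_atTop
      obtain ⟨mc, hc, -⟩ := h _ hβ
      obtain ⟨k, hk⟩ := hc.exists
      exact hno' _ _ hk
    · rw [tendsto_iff_seq_tendsto]
      intro β hβ
      obtain ⟨mc, hc, hmc⟩ := h β hβ
      refine hmc.congr' ?_
      filter_upwards [hc] with k hk
      exact (hk.csSup_eq hk.nonempty).symm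
  · rintro ⟨⟨β₀, hβ₀⟩, hlim⟩ β hβ
    refine ⟨fun k => sSup (NonMassive Nf (β k)), ?_, hlim.comp hβ⟩
    filter_upwards [hβ.eventually_ge_atTop β₀] with k hk
    obtain ⟨m, hm⟩ := hβ₀ _ hk
    exact isLUB_csSup hm.nonempty hm.bddAbove

/-- S2 in its final form: **S2 ⟺ `∀ N_f ∈ {2,3}, FixedCouplingCornerLaw N_f`**. [folklore] -/
theorem stubIntrinsicCorner_iff_fixedCoupling :
    StubIntrinsicCorner ↔ ∀ Nf : ℕ, Nf = 2 ∨ Nf = 3 → FixedCouplingCornerLaw Nf := by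
  rw [stubIntrinsicCorner_iff_cornerLaw]
  exact forall₂_congr fun Nf _ => cornerLaw_iff_fixedCoupling

/-- What the CRUX needs from S2 is only its instance along the anchor's own coupling sequence; conversely the
crux's witness proves the corner law along ONE divergent sequence (not S2). [folklore] -/
theorem cornerLaw_along_witness (h : HonestHeavyAnchor) (hNf : Nf = 2 ∨ Nf = 3) :
    ∃ β : ℕ → ℝ, Tendsto β atTop atTop ∧ ∃ mc : ℕ → ℝ, ∀ᶠ k in atTop, IsLUB (NonMassive Nf (β k)) (mc k) := by
  obtain ⟨reg, mc, hβ, hcorner, -, -⟩ := witness_corner_commitments h hNf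
  exact ⟨reg.β, hβ, mc, hcorner⟩

/-- The strict heavy body above `M` (verbatim the hypothesis `BodyAbove` of stubs S3/S4). -/
def BodyAbove (reg : QCDRegularisation Nf) (M : ℝ) : Prop :=
  ∀ m : Fin Nf → ℝ, (∀ f, M < m f) →
    ∃ (z shift : QCDField Nf → ℕ → ℝ) (T : OSData (QCDField Nf) 4),
      IsQCDAlong (reg.scheme m z shift) T ∧ T.IsNontrivial QCDField.glue ∧
        T.IsNonGaussian QCDField.glue ∧
          (∀ f g : Fin Nf, f ≠ g → T.IsNontrivial (QCDField.pseudoRe f g)) ∧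
            ∃ Δ > 0, T.HasMassGap Δ ∧ (reg.scheme m z shift).HasLatticeMassGap Δ

/-- SLACK in S3/S4: their hypothesis `(reg.scheme 0 0 0).HasAsymptoticScaling` is implied by their hypothesis
`BodyAbove reg M` (read off `IsQCDAlong` at the tuple `M + 1`; asymptotic scaling reads only `β_k, a_k`). [folklore] -/
theorem hasAsymptoticScaling_of_bodyAbove (reg : QCDRegularisation Nf) (M : ℝ) (h : BodyAbove reg M) :
    (reg.scheme 0 0 0).HasAsymptoticScaling := by
  obtain ⟨z, shift, T, hq, -⟩ := h (fun _ => M + 1) (fun _ => lt_add_one M)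
  exact hq.1

/-- The crux's non-strict body above `Mh` is the strict body above every `M ≥ Mh`… [folklore] -/
theorem bodyAbove_of_body (reg : QCDRegularisation Nf) {Mh M : ℝ} (hM : Mh ≤ M) (h : Body reg Mh) :
    BodyAbove reg M :=
  fun m hm => h m fun f => hM.trans (hm f).le

/-- … and the strict body above `M` gives the non-strict body above `M + 1`. [folklore] -/
theorem body_of_bodyAbove (reg : QCDRegularisation Nf) {M : ℝ} (h : BodyAbove reg M) : Body reg (M + 1) :=
  fun m hm => h m fun f => lt_of_lt_of_le (lt_add_one M) (hm f)

end Line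


/-! ## §6 Body side: what non-triviality commits the witness to at the lattice level -/

section BodySide

open scoped SchwartzMap
open MeasureTheory
open Literature.MathematicalPhysics.AQFT Literature.MathematicalPhysics.QuantumLattice
open Summit.QuantumFields.YangMills.Theorems.HypercubicLimit.Negative
  (tensor₁ tensor₂ isTensorOf_tensor₁ isTensorOf_tensor₂ isOffDiagonal_of_halfSpaces twoPointNontrivial_iff_real)

/-- **Non-triviality commits the witness at the lattice level**: if `T` is the limit of the scheme `sch`
(`IsQCDAlong sch T`) and the species `s` is non-trivial in `T`, then for some real one-point test functions `u`
(negative times) and `v` (positive times) the TRUNCATED LATTICE two-point value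
`⟨Φ^s(u) Φ^s(v)⟩_k − ⟨Φ^s(u)⟩_k ⟨Φ^s(v)⟩_k` is non-zero for all large `k` (bridge `twoPointNontrivial_iff_real` +
the convergence clause on the real off-diagonal tensors `u ⊗ v`, `u`, `v`). [folklore] -/
theorem lattice_truncated_eventually_ne_zero (sch : QCDScheme Nf) (T : OSData (QCDField Nf) 4) (s : QCDField Nf)
    (hq : IsQCDAlong sch T) (hT : T.IsNontrivial s) :
    ∃ u v : 𝓢(EuclideanSpace ℝ (Fin 4), ℝ),
      ∀ᶠ k in atTop, qcdLatticeSchwinger sch k (1 + 1) (fun _ => s) ![u, v] -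
        qcdLatticeSchwinger sch k 1 (fun _ => s) ![u] * qcdLatticeSchwinger sch k 1 (fun _ => s) ![v] ≠ 0 := by
  obtain ⟨u, v, hu, hv, hne⟩ := (twoPointNontrivial_iff_real T.schwinger s).1 hT
  obtain ⟨-, -, hconv⟩ := hq
  have h2 := hconv (1 + 1) (by norm_num) (fun _ => s) ![u, v] (tensor₂ u v) (isTensorOf_tensor₂ u v)
    (isOffDiagonal_of_halfSpaces hu hv (isTensorOf_tensor₂ u v))
  have h1u := hconv 1 one_ne_zero (fun _ => s) ![u] (tensor₁ u) (isTensorOf_tensor₁ u)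
    (isOffDiagonal_of_subsingleton _)
  have h1v := hconv 1 one_ne_zero (fun _ => s) ![v] (tensor₁ v) (isTensorOf_tensor₁ v)
    (isOffDiagonal_of_subsingleton _)
  exact ⟨u, v, (h2.sub (h1u.mul h1v)).eventually_ne (sub_ne_zero.2 hne)⟩

/-- Hence **the honest `(−1)^F`-twisted partition function at the scheme's own side `2L_k+1`, coupling `β_k` and bare
masses `m_f(k)` is NON-ZERO for all large `k`** — a zero denominator makes every lattice Schwinger function of step
`k` the junk value `0`, hence the truncated value `0`. [folklore] -/
theorem partition_eventually_ne_zero (sch : QCDScheme Nf) (T : OSData (QCDField Nf) 4) (s : QCDField Nf)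
    (hq : IsQCDAlong sch T) (hT : T.IsNontrivial s) :
    ∀ᶠ k in atTop,
      (∫ U, fermiIntegral (fermiBoltzmann U fun fl => sch.mq fl k) ∂(qcdGaugeMeasure sch k)) ≠ 0 := by
  obtain ⟨u, v, h⟩ := lattice_truncated_eventually_ne_zero sch T s hq hT
  filter_upwards [h] with k hk
  intro hZ
  apply hk
  simp [qcdLatticeSchwinger, hZ]

/-- … and **the multiplicative renormalisation `z_s(k)` of a non-trivial species is eventually non-zero**
(with `z_s(k) = 0` every insertion of species `s` at step `k` vanishes). [folklore] -/
theorem z_eventually_ne_zero (sch : QCDScheme Nf) (T : OSData (QCDField Nf) 4) (s : QCDField Nf)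
    (hq : IsQCDAlong sch T) (hT : T.IsNontrivial s) : ∀ᶠ k in atTop, sch.z s k ≠ 0 := by
  obtain ⟨u, v, h⟩ := lattice_truncated_eventually_ne_zero sch T s hq hT
  filter_upwards [h] with k hk
  intro hz
  apply hk
  simp [qcdLatticeSchwinger, smearedInsertion, List.ofFn_succ, hz]

/-- **Body-side commitment of any witness of the crux**: at EVERY heavy tuple `m` (all `m_f ≥ M_h`) the honest
twisted partition function `∫dμ_W(U) ∫dψ̄dψ e^{−ψ̄ D(U, m(k)) ψ}` on the torus of side `2L_k+1` at coupling `β_k` and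
bare masses `m_f(k) = m_crit(k) + a_k m_f/Z_m(k)` is non-zero for all large `k` (it reads neither `z` nor `shift`).
Since `m_crit(k) − mc(k) → 0` (§2) with `mc(k) = sup NonMassive(β_k)` expected `< 0` (`κ_c > 1/8`), the bare masses of
a witness are eventually NEGATIVE, where `∏_f det D_W(U, m_f(k))` is real but NOT configuration-wise positive
(`Literature.Barriers.QuantumFields.WilsonDeterminantSign`): for `N_f = 3`, or `N_f = 2` with `m_u ≠ m_d`, this is a
genuine (sign-problem) statement — cf. `stub_honestPartitionPos` of line `block-away-the-sign`
(crux `SpectralDefectExtinction.ExtinctionBuildsQCD`), which sets out to PROVE positivity. [folklore] -/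
theorem witness_partition_eventually_ne_zero (h : HonestHeavyAnchor) (hNf : Nf = 2 ∨ Nf = 3) :
    ∃ (reg : QCDRegularisation Nf) (Mh : ℝ), 0 < Mh ∧ ∀ m : Fin Nf → ℝ, (∀ f, Mh ≤ m f) →
      ∀ᶠ k in atTop,
        (∫ U, fermiIntegral (fermiBoltzmann U fun fl => (reg.scheme m 0 0).mq fl k)
          ∂(qcdGaugeMeasure (reg.scheme m 0 0) k)) ≠ 0 := by
  obtain ⟨reg, -, Mh, -, -, -, -, -, hMh, hbody⟩ := h Nf hNf
  refine ⟨reg, Mh, hMh, fun m hm => ?_⟩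
  obtain ⟨z, shift, T, hq, hN, -⟩ := hbody m hm
  exact partition_eventually_ne_zero (reg.scheme m z shift) T QCDField.glue hq hN

/-- Likewise every witness renormalises the glue and every flavour-changing pseudoscalar by eventually NON-ZERO
factors `z_s(k)`. [folklore] -/
theorem witness_z_eventually_ne_zero (h : HonestHeavyAnchor) (hNf : Nf = 2 ∨ Nf = 3) :
    ∃ (reg : QCDRegularisation Nf) (Mh : ℝ), 0 < Mh ∧ ∀ m : Fin Nf → ℝ, (∀ f, Mh ≤ m f) →
      ∃ (z shift : QCDField Nf → ℕ → ℝ) (T : OSData (QCDField Nf) 4), IsQCDAlong (reg.scheme m z shift) T ∧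
        (∀ᶠ k in atTop, z QCDField.glue k ≠ 0) ∧
          ∀ f g : Fin Nf, f ≠ g → ∀ᶠ k in atTop, z (QCDField.pseudoRe f g) k ≠ 0 := by
  obtain ⟨reg, -, Mh, -, -, -, -, -, hMh, hbody⟩ := h Nf hNf
  refine ⟨reg, Mh, hMh, fun m hm => ?_⟩
  obtain ⟨z, shift, T, hq, hN, -, hP, -⟩ := hbody m hm
  exact ⟨z, shift, T, hq, z_eventually_ne_zero (reg.scheme m z shift) T _ hq hN,
    fun f g hfg => z_eventually_ne_zero (reg.scheme m z shift) T _ hq (hP f g hfg)⟩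

end BodySide

end Summit.QuantumFields.QCD.Cruxes.HonestHeavyAnchor.Disproof

end
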